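import Summits.QuantumFields.YangMills.Theorems.BalabanUVNodesN21CollarOddsProduct

/-!
# N21 (NE7c) · THE COLLAR ODDS PRODUCT IN THE BLOCK FRAME: ROW P's `hQ` PRODUCED where ROW P consumes it
# (exterior law `ζ`, block `κ → ℝ`, any Gibbs density — the frame of parts 18 ∕ 27 ∕ 28)

R141 (C) seat pub-ymgap-dag-n21-e (g15), node N21 = NE7c (single-run shell-weight bound, NOT PRINTED in [Bałaban
1983–89], NOT proved), strategy s3 ALTERNATIVE CURRENCY, lane K3⁷ `SpineGivenEndpointR13SepCoPH`
(stmt-QuantumFields-20544, `--kind proof --supports … --as helper`).  Part 38j of this seat's series; successor of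
38i `…N21CollarOddsProduct` (p569648).

WHY.  The re-centred END of road II (lens `ym-lens-BalabanUVNodes-nearmiss` v27.0 ROW P, n21-d parts 27∕28
`…N21RecentredDilation[Transversal]`: P2 `slotAntiConcentration_restrict_of_recentredDilation`) consumes ONE envelope
odds binder `hQ : ν(Env ∖ ({U<θ} ∩ C)) ≤ Q · ν({U<θ} ∩ C)` for the cut law `ν = (ζ ⊗ vol).withDensity g` on the
PRODUCT frame `X × (κ → ℝ)` (exterior law `ζ`, dilated block `κ`).  38i §1
(`measure_biInter_env_diff_le_of_condOdds`) has exactly that SHAPE on any measure space (lens l.23151), but 38i §2's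
PRODUCER of the per-block conditional odds (`condOdds_coord_of_partialSlope`, `collarOddsProduct_of_partialSlopes`,
`envelopeOdds_of_collars`) is typed on `ι → ℝ` with `vol.withDensity e^{−A}` — G21's ∕ part 19's frame, where the
whole configuration is dilated about the chart centre.  This file ports the producer to the frame P2 consumes:
* §1 (any `X`, any `Y` with an s-finite reference measure `μ`, any density `g`) `lintegral_fibre_indicator_eq`,
  ★ `withDensity_prod_apply_eq_lintegral_fibre` (`ν S = ∫⁻ z, (μ.withDensity g(z,·))(S_z) dζ`, Tonelli) and
  `measure_le_mul_of_fibrewise` (a fibrewise bound `≤ c ×` integrates to the same bound for `ν`) — no s-finiteness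
  of the exterior law `ζ` is needed;
* §2 (block coordinate letter `p ↦ p.2 i`, `g = e^{−A}`, one-sided partial slope `Λ` of `A` along `w i` on the left
  shell `[a, b)` uniformly in `(z, w_{≠ i})`, an event `C` with `(z, update w i y) ∈ C ↔ (z, w) ∈ C`)
  `measure_blockCoordShell_le_of_partialSlope_of_notRead` (38i §2 `measure_coordSlice_le_of_partialSlope_of_notRead`
  on every `ζ`-fibre BY NAME + §1) and `condOdds_blockCoord_of_partialSlope` (G21 §1
  `measure_shell_inter_le_odds_of_condHazard` BY NAME);
* §3 (`M : Finset κ` collar coordinates, a measurable rest event `R` reading none of them)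
  ★ `collarOddsProduct_block_of_partialSlopes` (38i §1 `measure_biInter_env_le_prod_of_condOdds` BY NAME),
  `collarOddsProduct_block_le_pow` (38i `prod_one_add_le_pow_card`), ★ `envelopeOdds_block_of_collars` — P2's `hQ`
  with `Env := (⋂ᵢ {aᵢ ≤ p.2 i}) ∩ R`, `{U<θ} ∩ C = (⋂ᵢ {bᵢ ≤ p.2 i}) ∩ R`, `Q = (1+Q₀)^{#M} − 1` (so that P2's
  `(1+Q)` reads `(1+Q₀)^m`, the number 38h §1 charges against the per-cube currency by counting);
* §4 A6 witness (director-ym STANDING A6 RULE №189 (3)): `X = Unit` with `ζ = dirac ()`, `κ = Fin 2`, the Gaussian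
  block weight (38i §4's family BY NAME): `lintegral_blockGaussianWeight_ne_top`, `blockGaussianWeight_partialSlope`,
  ★ `collarOddsProductBlock_binders_inhabited` — §3's END with every binder discharged in the kernel.

HONEST FRAMING.  [textbook] measure theory (Tonelli slicing ∕ iterated conditioning) + real arithmetic; 0 def,
0 sorry; the slopes `Λᵢ`, shells `[aᵢ, bᵢ)` and the not-read structure of the rest event are HYPOTHESES (NODE O's
term object ∕ n21-d's hazard numbers), never estimated here; nothing of Bałaban's asserted ([Balaban1989LargeFieldI]
p. 176 ∕ p. 193 = the located MECHANISM only); NE7c NOT PRINTED ∕ NOT proved; N21 NOT discharged; counts unmoved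
(typed 28∕28 · discharged 5∕27); count-neutral; one finite 𝕋⁴ at fixed ε — nothing about ℝ⁴ ∕ OS ∕ mass gap ∕ Clay.
-/

set_option autoImplicit false

open MeasureTheory Set Function
open scoped ENNReal

namespace Summit.QuantumFields.YangMills.Theorems.N21CollarOddsBlockFrame

open Summit.QuantumFields.YangMills.Theorems.N21CollarOdds (measure_shell_inter_le_odds_of_condHazard)
open Summit.QuantumFields.YangMills.Theorems.N21CollarOddsProduct
  (measure_biInter_env_le_prod_of_condOdds prod_one_add_le_pow_card
    measure_coordSlice_le_of_partialSlope_of_notRead isFiniteMeasure_gaussianWeight gaussianWeight_partialSlope)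

/-! ## §1 Slicing a density on a product over the exterior law -/

section Slicing

variable {X Y : Type*} [MeasurableSpace X] [MeasurableSpace Y] (ζ : Measure X) (μ : Measure Y) [SFinite μ]

omit [SFinite μ] in
/-- on the fibre over `z`, the integral of `𝟙_S · g` is the fibre density's mass of the slice `S_z`. [textbook] -/
theorem lintegral_fibre_indicator_eq (g : X × Y → ℝ≥0∞) {S : Set (X × Y)} (hS : MeasurableSet S) (z : X) :
    ∫⁻ y, S.indicator g (z, y) ∂μ = (μ.withDensity fun y => g (z, y)) (Prod.mk z ⁻¹' S) := by
  rw [withDensity_apply _ (measurable_prodMk_left hS), ← lintegral_indicator (measurable_prodMk_left hS)]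
  exact lintegral_congr fun y => (indicator_comp_right (Prod.mk z) (s := S) (g := g) (x := y)).symm

/-- **SLICING** (Tonelli): for `ν = (ζ ⊗ μ).withDensity g` with `g` measurable and `μ` s-finite,
`ν S = ∫⁻ z, (μ.withDensity g(z,·)) (S_z) dζ` for every measurable `S` — the cut law's mass of an event is the
exterior average of its fibre masses. [textbook] -/
theorem withDensity_prod_apply_eq_lintegral_fibre {g : X × Y → ℝ≥0∞} (hg : Measurable g)
    {S : Set (X × Y)} (hS : MeasurableSet S) :
    ((ζ.prod μ).withDensity g) S = ∫⁻ z, (μ.withDensity fun y => g (z, y)) (Prod.mk z ⁻¹' S) ∂ζ := by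
  rw [withDensity_apply _ hS, ← lintegral_indicator hS, lintegral_prod _ (hg.indicator hS).aemeasurable]
  exact lintegral_congr fun z => lintegral_fibre_indicator_eq μ g hS z

/-- **FIBREWISE DOMINATION INTEGRATES**: if on every exterior fibre the slice of `S` carries at most `c` times the
mass of the slice of `T`, then `ν S ≤ c · ν T`. [textbook] -/
theorem measure_le_mul_of_fibrewise {g : X × Y → ℝ≥0∞} (hg : Measurable g) {S T : Set (X × Y)}
    (hS : MeasurableSet S) (hT : MeasurableSet T) (c : ℝ≥0∞)
    (hfib : ∀ z : X, (μ.withDensity fun y => g (z, y)) (Prod.mk z ⁻¹' S)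
      ≤ c * (μ.withDensity fun y => g (z, y)) (Prod.mk z ⁻¹' T)) :
    ((ζ.prod μ).withDensity g) S ≤ c * ((ζ.prod μ).withDensity g) T := by
  have hF : Measurable fun z => (μ.withDensity fun y => g (z, y)) (Prod.mk z ⁻¹' T) := by
    have h := (hg.indicator hT).lintegral_prod_right' (ν := μ)
    have e : (fun z => (μ.withDensity fun y => g (z, y)) (Prod.mk z ⁻¹' T))
        = fun z => ∫⁻ y, T.indicator g (z, y) ∂μ := funext fun z => (lintegral_fibre_indicator_eq μ g hT z).symm
    rw [e]
    exact h
  rw [withDensity_prod_apply_eq_lintegral_fibre ζ μ hg hS, withDensity_prod_apply_eq_lintegral_fibre ζ μ hg hT,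
    ← lintegral_const_mul c hF]
  exact lintegral_mono hfib

end Slicing

/-! ## §2 One collar block in the block frame: a coordinate letter of the dilated block -/

section Block

variable {X : Type*} [MeasurableSpace X] (ζ : Measure X) {κ : Type*} [Fintype κ] [DecidableEq κ]

/-- **38i §2 ON EVERY EXTERIOR FIBRE.**  `ν = (ζ ⊗ vol).withDensity e^{−A}` on `X × (κ → ℝ)`, `A` measurable with
one-sided partial slope `≤ Λ` along the block coordinate `w i` on the right `Λ⁻¹`-neighbourhoods of `[a, b)`,
uniformly in the exterior point `z` and the other block coordinates; `C` measurable with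
`(z, update w i y) ∈ C ↔ (z, w) ∈ C`.  Then `ν({a ≤ p.2 i < b} ∩ C) ≤ e·Λ·(b − a) · ν({a ≤ p.2 i} ∩ C)`. [textbook] -/
theorem measure_blockCoordShell_le_of_partialSlope_of_notRead {A : X × (κ → ℝ) → ℝ} (hA : Measurable A) (i : κ)
    {a b Λ : ℝ} (hΛ : 0 < Λ)
    (hslope : ∀ (z : X) (w : κ → ℝ), ∀ y₁ ∈ Ico a b, ∀ y₂ ∈ Icc y₁ (y₁ + Λ⁻¹),
      A (z, update w i y₂) - A (z, update w i y₁) ≤ Λ * (y₂ - y₁))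
    {C : Set (X × (κ → ℝ))} (hC : MeasurableSet C) (hCi : ∀ z w y, (z, update w i y) ∈ C ↔ (z, w) ∈ C) :
    ((ζ.prod volume).withDensity fun p : X × (κ → ℝ) => ENNReal.ofReal (Real.exp (-A p)))
        ({p | a ≤ p.2 i ∧ p.2 i < b} ∩ C)
      ≤ ENNReal.ofReal (Real.exp 1 * Λ * (b - a)) *
        ((ζ.prod volume).withDensity fun p : X × (κ → ℝ) => ENNReal.ofReal (Real.exp (-A p)))
          ({p | a ≤ p.2 i} ∩ C) := by
  have hg : Measurable fun p : X × (κ → ℝ) => ENNReal.ofReal (Real.exp (-A p)) :=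
    ENNReal.measurable_ofReal.comp (Real.measurable_exp.comp hA.neg)
  have hu : Measurable fun p : X × (κ → ℝ) => p.2 i := (measurable_pi_apply i).comp measurable_snd
  have hS : MeasurableSet ({p : X × (κ → ℝ) | a ≤ p.2 i ∧ p.2 i < b} ∩ C) :=
    ((measurableSet_le measurable_const hu).inter (measurableSet_lt hu measurable_const)).inter hC
  have hT : MeasurableSet ({p : X × (κ → ℝ) | a ≤ p.2 i} ∩ C) := (measurableSet_le measurable_const hu).inter hC
  refine measure_le_mul_of_fibrewise ζ volume hg hS hT _ fun z => ?_
  have hAz : Measurable fun w : κ → ℝ => A (z, w) := hA.comp measurable_prodMk_left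
  exact measure_coordSlice_le_of_partialSlope_of_notRead hAz i hΛ
    (fun w y₁ hy₁ y₂ hy₂ => hslope z w y₁ hy₁ y₂ hy₂) (measurable_prodMk_left hC) (fun w y => hCi z w y)

/-- **CONDITIONAL ODDS OF ONE COLLAR BLOCK IN THE BLOCK FRAME.**  Same data with `ν` finite, `a ≤ b` and
`c := e·Λ·(b − a) < 1`: `ν({a ≤ p.2 i < b} ∩ C) ≤ c∕(1−c) · ν({b ≤ p.2 i} ∩ C)` — the left shell of the dropped
cut, conditioned on any event not reading the coordinate, is carried by the conditioned exceedance (G21 §1 BY NAME). [textbook] -/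
theorem condOdds_blockCoord_of_partialSlope {A : X × (κ → ℝ) → ℝ} (hA : Measurable A)
    [IsFiniteMeasure ((ζ.prod volume).withDensity fun p : X × (κ → ℝ) => ENNReal.ofReal (Real.exp (-A p)))]
    (i : κ) {a b Λ : ℝ} (hΛ : 0 < Λ) (hab : a ≤ b) (hc1 : Real.exp 1 * Λ * (b - a) < 1)
    (hslope : ∀ (z : X) (w : κ → ℝ), ∀ y₁ ∈ Ico a b, ∀ y₂ ∈ Icc y₁ (y₁ + Λ⁻¹),
      A (z, update w i y₂) - A (z, update w i y₁) ≤ Λ * (y₂ - y₁))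
    {C : Set (X × (κ → ℝ))} (hC : MeasurableSet C) (hCi : ∀ z w y, (z, update w i y) ∈ C ↔ (z, w) ∈ C) :
    ((ζ.prod volume).withDensity fun p : X × (κ → ℝ) => ENNReal.ofReal (Real.exp (-A p)))
        ({p | a ≤ p.2 i ∧ p.2 i < b} ∩ C)
      ≤ ENNReal.ofReal (Real.exp 1 * Λ * (b - a) / (1 - Real.exp 1 * Λ * (b - a))) *
        ((ζ.prod volume).withDensity fun p : X × (κ → ℝ) => ENNReal.ofReal (Real.exp (-A p)))
          ({p | b ≤ p.2 i} ∩ C) := by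
  have hu : Measurable fun p : X × (κ → ℝ) => p.2 i := (measurable_pi_apply i).comp measurable_snd
  have hc0 : 0 ≤ Real.exp 1 * Λ * (b - a) :=
    mul_nonneg (mul_nonneg (Real.exp_pos 1).le hΛ.le) (sub_nonneg.2 hab)
  exact measure_shell_inter_le_odds_of_condHazard _ hu _ hc0 hc1
    (measure_blockCoordShell_le_of_partialSlope_of_notRead ζ hA i hΛ hslope hC hCi)

/-! ## §3 The product over the collar blocks of a sent component, and P2's `hQ` -/

/-- **THE PRODUCT OF COLLAR ODDS IN THE BLOCK FRAME.**  `ν = (ζ ⊗ vol).withDensity e^{−A}` of finite mass on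
`X × (κ → ℝ)`; collar coordinates `M : Finset κ` of the dilated block, each with its left shell `[aᵢ, bᵢ)` below
its dropped `≥`-cut `{bᵢ ≤ p.2 i}`, a one-sided partial slope `Λᵢ > 0` along `w i` there (uniformly in the exterior
point and the other block coordinates) and `cᵢ := e·Λᵢ·(bᵢ − aᵢ) < 1`; `R` any measurable rest event reading no
collar coordinate.  Then `ν((⋂_{i∈M} {aᵢ ≤ p.2 i}) ∩ R) ≤ ∏_{i∈M} (1 + cᵢ∕(1−cᵢ)) · ν((⋂_{i∈M} {bᵢ ≤ p.2 i}) ∩ R)`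
(38i §1 `measure_biInter_env_le_prod_of_condOdds` BY NAME, fed by §2). [textbook] -/
theorem collarOddsProduct_block_of_partialSlopes {A : X × (κ → ℝ) → ℝ} (hA : Measurable A)
    [IsFiniteMeasure ((ζ.prod volume).withDensity fun p : X × (κ → ℝ) => ENNReal.ofReal (Real.exp (-A p)))]
    (M : Finset κ) {a b Λ : κ → ℝ} (hΛ : ∀ i ∈ M, 0 < Λ i) (hab : ∀ i ∈ M, a i ≤ b i)
    (hc1 : ∀ i ∈ M, Real.exp 1 * Λ i * (b i - a i) < 1)
    (hslope : ∀ i ∈ M, ∀ (z : X) (w : κ → ℝ), ∀ y₁ ∈ Ico (a i) (b i), ∀ y₂ ∈ Icc y₁ (y₁ + (Λ i)⁻¹),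
      A (z, update w i y₂) - A (z, update w i y₁) ≤ Λ i * (y₂ - y₁))
    {R : Set (X × (κ → ℝ))} (hRm : MeasurableSet R) (hR : ∀ i ∈ M, ∀ z w y, (z, update w i y) ∈ R ↔ (z, w) ∈ R) :
    ((ζ.prod volume).withDensity fun p : X × (κ → ℝ) => ENNReal.ofReal (Real.exp (-A p)))
        ((⋂ i ∈ M, {p : X × (κ → ℝ) | a i ≤ p.2 i}) ∩ R)
      ≤ ENNReal.ofReal (∏ i ∈ M, (1 + Real.exp 1 * Λ i * (b i - a i) / (1 - Real.exp 1 * Λ i * (b i - a i)))) *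
        ((ζ.prod volume).withDensity fun p : X × (κ → ℝ) => ENNReal.ofReal (Real.exp (-A p)))
          ((⋂ i ∈ M, {p : X × (κ → ℝ) | b i ≤ p.2 i}) ∩ R) := by
  have hc0 : ∀ i ∈ M, 0 ≤ Real.exp 1 * Λ i * (b i - a i) := fun i hi =>
    mul_nonneg (mul_nonneg (Real.exp_pos 1).le (hΛ i hi).le) (sub_nonneg.2 (hab i hi))
  have hu : ∀ j : κ, Measurable fun p : X × (κ → ℝ) => p.2 j := fun j => (measurable_pi_apply j).comp measurable_snd
  refine measure_biInter_env_le_prod_of_condOdds _ (fun i => {p : X × (κ → ℝ) | b i ≤ p.2 i})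
    (fun i => {p : X × (κ → ℝ) | a i ≤ p.2 i}) _
    (fun i C => MeasurableSet C ∧ ∀ (z : X) (w : κ → ℝ) (y : ℝ), (z, update w i y) ∈ C ↔ (z, w) ∈ C) M
    (fun i hi => div_nonneg (hc0 i hi) (sub_nonneg.2 (hc1 i hi).le)) ?_ ?_ ?_ (fun i hi => ⟨hRm, hR i hi⟩)
  · rintro i - j - hji C ⟨hCm, hCi⟩
    refine ⟨(measurableSet_le measurable_const (hu j)).inter hCm, fun z w y => ?_⟩
    simp only [mem_inter_iff, mem_setOf_eq, update_of_ne hji, hCi]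
  · rintro i - j - hji C ⟨hCm, hCi⟩
    refine ⟨(measurableSet_le measurable_const (hu j)).inter hCm, fun z w y => ?_⟩
    simp only [mem_inter_iff, mem_setOf_eq, update_of_ne hji, hCi]
  · rintro i hi C ⟨hCm, hCi⟩
    have hEP : ({p : X × (κ → ℝ) | a i ≤ p.2 i} \ {p | b i ≤ p.2 i}) = {p | a i ≤ p.2 i ∧ p.2 i < b i} := by
      ext p; simp only [mem_sdiff, mem_setOf_eq, not_le]
    rw [hEP]
    exact condOdds_blockCoord_of_partialSlope ζ hA i (hΛ i hi) (hab i hi) (hc1 i hi) (hslope i hi) hCm hCi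

/-- **… WITH A UNIFORM ODDS BOUND**: block odds `cᵢ∕(1−cᵢ) ≤ Q₀` give the factor `(1+Q₀)^{#M}` (38h §1's shape,
38i `prod_one_add_le_pow_card`). [textbook] -/
theorem collarOddsProduct_block_le_pow {A : X × (κ → ℝ) → ℝ} (hA : Measurable A)
    [IsFiniteMeasure ((ζ.prod volume).withDensity fun p : X × (κ → ℝ) => ENNReal.ofReal (Real.exp (-A p)))]
    (M : Finset κ) {a b Λ : κ → ℝ} {Q₀ : ℝ} (hΛ : ∀ i ∈ M, 0 < Λ i) (hab : ∀ i ∈ M, a i ≤ b i)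
    (hc1 : ∀ i ∈ M, Real.exp 1 * Λ i * (b i - a i) < 1)
    (hQ₀ : ∀ i ∈ M, Real.exp 1 * Λ i * (b i - a i) / (1 - Real.exp 1 * Λ i * (b i - a i)) ≤ Q₀)
    (hslope : ∀ i ∈ M, ∀ (z : X) (w : κ → ℝ), ∀ y₁ ∈ Ico (a i) (b i), ∀ y₂ ∈ Icc y₁ (y₁ + (Λ i)⁻¹),
      A (z, update w i y₂) - A (z, update w i y₁) ≤ Λ i * (y₂ - y₁))
    {R : Set (X × (κ → ℝ))} (hRm : MeasurableSet R) (hR : ∀ i ∈ M, ∀ z w y, (z, update w i y) ∈ R ↔ (z, w) ∈ R) :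
    ((ζ.prod volume).withDensity fun p : X × (κ → ℝ) => ENNReal.ofReal (Real.exp (-A p)))
        ((⋂ i ∈ M, {p : X × (κ → ℝ) | a i ≤ p.2 i}) ∩ R)
      ≤ ENNReal.ofReal ((1 + Q₀) ^ M.card) *
        ((ζ.prod volume).withDensity fun p : X × (κ → ℝ) => ENNReal.ofReal (Real.exp (-A p)))
          ((⋂ i ∈ M, {p : X × (κ → ℝ) | b i ≤ p.2 i}) ∩ R) := by
  have hQ0 : ∀ i ∈ M, 0 ≤ Real.exp 1 * Λ i * (b i - a i) / (1 - Real.exp 1 * Λ i * (b i - a i)) := fun i hi =>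
    div_nonneg (mul_nonneg (mul_nonneg (Real.exp_pos 1).le (hΛ i hi).le) (sub_nonneg.2 (hab i hi)))
      (sub_nonneg.2 (hc1 i hi).le)
  refine (collarOddsProduct_block_of_partialSlopes ζ hA M hΛ hab hc1 hslope hRm hR).trans ?_
  gcongr; exact prod_one_add_le_pow_card M hQ0 hQ₀

/-- **P2's `hQ`, PRODUCED.**  Same data: with the component's support inside the rest
`P := (⋂_{i∈M} {bᵢ ≤ p.2 i}) ∩ R` and the envelope `Env := (⋂_{i∈M} {aᵢ ≤ p.2 i}) ∩ R` (support ∪ left shells, where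
the inward dilates about the centre land), `ν(Env ∖ P) ≤ ((1+Q₀)^{#M} − 1) · ν(P)` — the binder `hQ` of
`…N21RecentredDilationTransversal.slotAntiConcentration_restrict_of_recentredDilation` (P2; its `{U<θ} ∩ C` is `P`
once `C = C⋆ ∩ ⋂ᵢ {bᵢ ≤ p.2 i}` and the rest is `R = {U<θ} ∩ C⋆`, reading no collar coordinate), IN P2's FRAME, for
`m = #M` dropped `≥`-cuts; P2's `(1+Q)` then reads `(1+Q₀)^m`. [textbook] -/
theorem envelopeOdds_block_of_collars {A : X × (κ → ℝ) → ℝ} (hA : Measurable A)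
    [IsFiniteMeasure ((ζ.prod volume).withDensity fun p : X × (κ → ℝ) => ENNReal.ofReal (Real.exp (-A p)))]
    (M : Finset κ) {a b Λ : κ → ℝ} {Q₀ : ℝ} (hΛ : ∀ i ∈ M, 0 < Λ i) (hab : ∀ i ∈ M, a i ≤ b i)
    (hc1 : ∀ i ∈ M, Real.exp 1 * Λ i * (b i - a i) < 1)
    (hQ₀ : ∀ i ∈ M, Real.exp 1 * Λ i * (b i - a i) / (1 - Real.exp 1 * Λ i * (b i - a i)) ≤ Q₀)
    (hslope : ∀ i ∈ M, ∀ (z : X) (w : κ → ℝ), ∀ y₁ ∈ Ico (a i) (b i), ∀ y₂ ∈ Icc y₁ (y₁ + (Λ i)⁻¹),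
      A (z, update w i y₂) - A (z, update w i y₁) ≤ Λ i * (y₂ - y₁))
    {R : Set (X × (κ → ℝ))} (hRm : MeasurableSet R) (hR : ∀ i ∈ M, ∀ z w y, (z, update w i y) ∈ R ↔ (z, w) ∈ R) :
    ((ζ.prod volume).withDensity fun p : X × (κ → ℝ) => ENNReal.ofReal (Real.exp (-A p)))
        (((⋂ i ∈ M, {p : X × (κ → ℝ) | a i ≤ p.2 i}) ∩ R) \ ((⋂ i ∈ M, {p : X × (κ → ℝ) | b i ≤ p.2 i}) ∩ R))
      ≤ ENNReal.ofReal ((1 + Q₀) ^ M.card - 1) *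
        ((ζ.prod volume).withDensity fun p : X × (κ → ℝ) => ENNReal.ofReal (Real.exp (-A p)))
          ((⋂ i ∈ M, {p : X × (κ → ℝ) | b i ≤ p.2 i}) ∩ R) := by
  have hu : ∀ j : κ, Measurable fun p : X × (κ → ℝ) => p.2 j := fun j => (measurable_pi_apply j).comp measurable_snd
  have hPm : MeasurableSet ((⋂ i ∈ M, {p : X × (κ → ℝ) | b i ≤ p.2 i}) ∩ R) :=
    (Finset.measurableSet_biInter M fun i _ => measurableSet_le measurable_const (hu i)).inter hRm
  have hsub : (⋂ i ∈ M, {p : X × (κ → ℝ) | b i ≤ p.2 i}) ∩ R ⊆ (⋂ i ∈ M, {p : X × (κ → ℝ) | a i ≤ p.2 i}) ∩ R :=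
    inter_subset_inter_left _ (iInter₂_mono fun i hi p hp => (hab i hi).trans hp)
  have hfin := measure_ne_top ((ζ.prod volume).withDensity fun p : X × (κ → ℝ) => ENNReal.ofReal (Real.exp (-A p)))
    ((⋂ i ∈ M, {p : X × (κ → ℝ) | b i ≤ p.2 i}) ∩ R)
  rw [measure_sdiff hsub hPm.nullMeasurableSet hfin, ENNReal.ofReal_sub _ zero_le_one, ENNReal.ofReal_one,
    ENNReal.sub_mul (fun _ _ => hfin), one_mul]
  exact tsub_le_tsub_right (collarOddsProduct_block_le_pow ζ hA M hΛ hab hc1 hQ₀ hslope hRm hR) _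

end Block

/-! ## §4 A6 witness: the binders of §3 are jointly inhabited (trivial exterior, Gaussian block weight, two collars) -/

section Witness

variable {κ : Type*} [Fintype κ] [DecidableEq κ]

omit [DecidableEq κ] in
/-- the Gaussian block weight `e^{−Σᵢ wᵢ²∕2}` over the one-point exterior has finite mass against
`dirac () ⊗ vol` (Tonelli + 38i §4 `isFiniteMeasure_gaussianWeight` BY NAME). [textbook] -/
theorem lintegral_blockGaussianWeight_ne_top :
    ∫⁻ p, ENNReal.ofReal (Real.exp (-(∑ i, p.2 i ^ 2 / 2))) ∂((Measure.dirac ()).prod (volume : Measure (κ → ℝ)))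
      ≠ ⊤ := by
  have hG : Measurable fun w : κ → ℝ => ENNReal.ofReal (Real.exp (-(∑ i, w i ^ 2 / 2))) :=
    ENNReal.measurable_ofReal.comp (Real.measurable_exp.comp
      (Finset.measurable_sum _ fun i _ => ((measurable_pi_apply i).pow_const 2).div_const 2).neg)
  have hg : Measurable fun p : Unit × (κ → ℝ) => ENNReal.ofReal (Real.exp (-(∑ i, p.2 i ^ 2 / 2))) :=
    hG.comp measurable_snd
  rw [lintegral_prod _ hg.aemeasurable, lintegral_dirac]
  have hfin := isFiniteMeasure_gaussianWeight (ι := κ)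
  have h := measure_lt_top (volume.withDensity fun w : κ → ℝ => ENNReal.ofReal (Real.exp (-(∑ i, w i ^ 2 / 2))))
    univ
  rw [withDensity_apply _ MeasurableSet.univ, Measure.restrict_univ] at h
  exact h.ne

omit [DecidableEq κ] in
/-- the Gaussian block weight's finite mass as an instance-shaped fact for §3. [textbook] -/
theorem isFiniteMeasure_blockGaussianWeight :
    IsFiniteMeasure (((Measure.dirac ()).prod (volume : Measure (κ → ℝ))).withDensity
      fun p : Unit × (κ → ℝ) => ENNReal.ofReal (Real.exp (-(∑ i, p.2 i ^ 2 / 2)))) := by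
  refine ⟨?_⟩
  rw [withDensity_apply _ MeasurableSet.univ, Measure.restrict_univ]
  exact (lintegral_blockGaussianWeight_ne_top (κ := κ)).lt_top

/-- the Gaussian block weight's action has one-sided partial slope `≤ 2` along any block coordinate on the right
`½`-neighbourhoods of `[0, 1∕6)`, uniformly in the (trivial) exterior point (38i §4 `gaussianWeight_partialSlope`). [textbook] -/
theorem blockGaussianWeight_partialSlope (i : κ) :
    ∀ (z : Unit) (w : κ → ℝ), ∀ y₁ ∈ Ico (0 : ℝ) (1 / 6), ∀ y₂ ∈ Icc y₁ (y₁ + (2 : ℝ)⁻¹),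
      (∑ j, (z, update w i y₂).2 j ^ 2 / 2) - (∑ j, (z, update w i y₁).2 j ^ 2 / 2) ≤ 2 * (y₂ - y₁) :=
  fun _ w y₁ hy₁ y₂ hy₂ => gaussianWeight_partialSlope i w y₁ hy₁ y₂ hy₂

/-- **A6 WITNESS** (director-ym STANDING A6 RULE №189 (3)): §3's END `collarOddsProduct_block_of_partialSlopes`
APPLIED — exterior `X = Unit` under `dirac ()`, block `ℝ²` under the Gaussian weight, both block coordinates collar
coordinates with left shell `[0, 1∕6)` below the cut `{1∕6 ≤ wᵢ}`, slope `Λ = 2` (`c = e∕3 < 1`), rest event `univ`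
— every binder discharged in the kernel; a satisfiability witness, not an estimate on Bałaban's measure. [textbook] -/
theorem collarOddsProductBlock_binders_inhabited :
    (((Measure.dirac ()).prod (volume : Measure (Fin 2 → ℝ))).withDensity
        fun p : Unit × (Fin 2 → ℝ) => ENNReal.ofReal (Real.exp (-(∑ i, p.2 i ^ 2 / 2))))
        ((⋂ i ∈ (Finset.univ : Finset (Fin 2)), {p : Unit × (Fin 2 → ℝ) | (0 : ℝ) ≤ p.2 i}) ∩ univ)
      ≤ ENNReal.ofReal (∏ _i ∈ (Finset.univ : Finset (Fin 2)),
            (1 + Real.exp 1 * 2 * ((1 : ℝ) / 6 - 0) / (1 - Real.exp 1 * 2 * ((1 : ℝ) / 6 - 0)))) *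
        (((Measure.dirac ()).prod (volume : Measure (Fin 2 → ℝ))).withDensity
          fun p : Unit × (Fin 2 → ℝ) => ENNReal.ofReal (Real.exp (-(∑ i, p.2 i ^ 2 / 2))))
          ((⋂ i ∈ (Finset.univ : Finset (Fin 2)), {p : Unit × (Fin 2 → ℝ) | (1 : ℝ) / 6 ≤ p.2 i}) ∩ univ) := by
  haveI := isFiniteMeasure_blockGaussianWeight (κ := Fin 2)
  have hA : Measurable fun p : Unit × (Fin 2 → ℝ) => ∑ i, p.2 i ^ 2 / 2 :=
    Finset.measurable_sum _ fun i _ => (((measurable_pi_apply i).comp measurable_snd).pow_const 2).div_const 2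
  have he : Real.exp 1 * 2 * ((1 : ℝ) / 6 - 0) < 1 := by nlinarith [Real.exp_one_lt_d9]
  exact collarOddsProduct_block_of_partialSlopes (Measure.dirac ()) hA Finset.univ (a := fun _ => (0 : ℝ))
    (b := fun _ => (1 : ℝ) / 6) (Λ := fun _ => (2 : ℝ)) (fun _ _ => by norm_num) (fun _ _ => by norm_num)
    (fun _ _ => he) (fun i _ => blockGaussianWeight_partialSlope i) MeasurableSet.univ (fun _ _ _ _ _ => by simp)

end Witness

end Summit.QuantumFields.YangMills.Theorems.N21CollarOddsBlockFrame
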